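import Summits.ABC.IUTFork.Cor312HullGluedContainer
import Summits.ABC.IUTFork.Cor312NotPointwiseDHVolBInputs
import HarnessLib

/-!
# [IUTchIII] Cor. 3.12 — CONTAINERS for the hull-glued setting at the assembled real setting, ANY prime (ramified and
# `p = 2` included): `^{n,∘}𝒰♮_{j,p}` inside an explicit hull-set, and `μ^log(^{n,∘}𝒰♮_{j,p}) ≤ W_{j,p}·log(p⁴·R²·ρ/r²)`

PROOF-ONLY sequel (abc-iut cell, seat abc-iut-w5-d082, WAVE-5; row «HULLGLUED-CONTAINER» named by abc-iut-w5-d121) of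
`Cor312HullGluedContainer` (this seat), abc-iut-w5-d060's `Cor312HullGluedDHVolGlobal`, abc-iut-c312-5's
`Cor312HullGluedDHVolSharpGlobal` (p430293) and abc-iut-w4-d107's `Cor312NotPointwiseDHVol*` (p422281 …). TAKES NO SIDE on
[IUTchIII] Cor. 3.12; no definition, no `Prop` fact.

At abc-iut-c312-5's assembled Dupuy–Hilado-level real setting `Real.settingDHVol` (verbatim container, weights
`w_{v⃗} = [F:ℚ]^{−(j+1)}`), at a packet `(j, p)` = `(labelSucc i₀, p)` for ANY prime `p`, let `r`, `R` be an inner and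
an outer coordinate radius of the log-shell lattice `ψ(Π_{v⃗} I_{v⃗})` (`latticeF 1`; abc-iut-c312-5
`exists_ball_subset_latticeF` / `exists_norm_le_of_mem_latticeF`) and suppose the Θ-boxes lie in the coordinate
polydisc of radius `ρ`. The mechanism of [IUTchIV] Thm. 1.10 Step (v) (kurims pp. 27–29: at a general `v ∈ 𝕍^non` the
possible images are bounded by a CONTAINER, Prop. 1.4 (iii); only Step (vi) has "container = ⊗ log-shells" exactly),
typed by abc-iut-w4-d107 for the setting `P` itself, is run here ONE MORE TIME for `P♮ := P.hullGlued`: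

* `exists_latticePk_sandwich` — a coordinate polydisc of radius `ρ` lies in an (Ind1)/(Ind2)-STABLE scaled log-shell
  lattice `e⁻¹(Π_{v⃗} c·I_{v⃗})` (abc-iut-c312-5 `latticePk`, `family_image_latticePk`), which lies in the hull-set
  `e⁻¹(p^{−N}·𝒪_L)` with `p^N ≤ p²·R·ρ/r`;
* `thetaHull_settingDHVol_subset_hullSet_of_polydisc` — hence `^{n,∘}𝒰_{j,p} ⊆ e⁻¹(p^{−N}·𝒪_L)`, `p^N ≤ p²·R·ρ/r` (the SET
  behind w4-d107's volume bound `thetaLocal_settingPrVol_untopD_le_of_polydisc`);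
* **`hullGlued_thetaHull_settingDHVol_subset_hullSet_of_polydisc`** — and, running the sandwich on that polydisc,
  `^{n,∘}𝒰♮_{j,p} ⊆ e⁻¹(p^{−N'}·𝒪_L)` with `p^{N'} ≤ p⁴·R²·ρ/r²` — NO stability of `^{n,∘}𝒰` (which FAILS at odd tamely
  ramified packets, c312-5's finding; `Cor312Ind2BallsRamified`);
* volumes (`logvol_situationDHVol_preimage_hullSet_of_norm_eq`: `μ^log(e⁻¹(λ·𝒪_L)) = W_{j,p}·log ρ` for a centre with
  all coordinates of norm `ρ`, `W_{j,p} := Σ_{v⃗} w_{v⃗} = (#{v | p}/[F:ℚ])^{j+1}`): under abc-iut-c312-6's `BridgeHyps`,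
  `thetaLocal_settingDHVol_untopD_le_of_polydisc` (`μ^log(^{n,∘}𝒰_{j,p}) ≤ W_{j,p}·log(p²·R·ρ/r)`, the DH-weight twin of
  w4-d107's) and **`hullGlued_thetaLocal_settingDHVol_untopD_le_of_polydisc`**
  (`μ^log(^{n,∘}𝒰♮_{j,p}) ≤ W_{j,p}·log(p⁴·R²·ρ/r²)`): the hull-gluing costs AT MOST `W_{j,p}·log(p²·R/r)` over the
  container bound for `P`, a constant of the packet NOT READING the Θ-data.
The SHARP setting of record (`Real.settingDHVolSharp`: the window box ≤ hull ≤ glued hull ≤ container at every prime,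
and the GLOBAL sum over the packets `p ∣ 2·disc(F)`, where alone `^{n,∘}𝒰♮ ≠ ^{n,∘}𝒰` is possible, p430293) is the
companion `Cor312HullGluedDHVolContainerSharp`. Reading (neutral): at the finitely many exceptional packets the
hull-gluing bracket is a WINDOW of explicit width, located by the log-shell radii of the packet; nothing here asserts
either Statement or constrains the Θ-glue. [claim: Mochizuki2012, status: disputed] vocabulary only.
[cite: Mochizuki2012, IUTchIV Thm 1.10 proof Step (v) pp. 27–29, Prop. 1.4 (iii) p. 13] [cite: DupuyHilado2025, §3.9, §4.9, §4.10]
-/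

noncomputable section

open Set Function
open scoped Pointwise

namespace Summit.ABC.IUTFork.Thm311.Real

open Cor312 Cor312.Setting Cor312Vol Literature.IUT.LogThetaLattice Literature.IUT.LogVolume

variable {F : Type} [Field F] [NumberField F] (X : PilotData F) {logv : PadicLogs F} (hlog : LogvAnalytic logv)
  (M : Type) [Field M] [NumberField M]
  (archPk : ∀ (j : (thetaIndex X).Label) (vQ : (thetaIndex X).VQ), Set ((logShellsDH X logv).Packet j vQ))
  (archSub : ∀ (j : (thetaIndex X).Label) (v : (thetaIndex X).V),
    Set ((logShellsDH X logv).Packet j ((thetaIndex X).over v)))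
  (Ψ : ℤ → ∀ v : (thetaIndex X).V, v ∈ (thetaIndex X).Vbad → Set ((logShellsDH X logv).StarPacket v))
  (act : ℤ → ∀ v : (thetaIndex X).V, v ∈ (thetaIndex X).Vbad →
    (logShellsDH X logv).StarPacket v → Module.End ℚ ((logShellsDH X logv).StarPacket v))
  (Mmod : ℤ → ∀ j : (thetaIndex X).LabelStar, Set ((logShellsDH X logv).GlobalPacket j.1))
  (region : ℤ → ∀ j : (thetaIndex X).LabelStar, FinDivisor M → ∀ vQ : (thetaIndex X).VQ,
    Set ((logShellsDH X logv).Packet j.1 vQ))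
  (n : ℤ) {HT : Type} {LogLink : HT → HT → Type} {IsFull : ∀ {s t : HT}, LogLink s t → Prop}
  (lat : LGPGaussianLogThetaLattice LogLink IsFull)
  {Frd : Type} {IsoF : Frd → Frd → Type} {Ob : Frd → Type} {realify : Frd → Frd} {Strip : Type}
  {IsoS : Strip → Strip → Type} {Mv : ∀ v : (thetaIndex X).V, v ∈ (thetaIndex X).Vbad → Type}
  [∀ v h, Monoid (Mv v h)]
  (sig : GlobalLGPFrobenioidSignature (thetaIndex X).lstar (thetaIndex X).V (· ∈ (thetaIndex X).Vbad)
    Frd IsoF Ob realify Strip IsoS Mv)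
  (split : SplittingMonoids Mv) {ObΔ : Type} {N : ∀ v : (thetaIndex X).V, v ∈ (thetaIndex X).Vbad → Type}
  [∀ v h, Monoid (N v h)] (qData : QPilotData ObΔ N)

/-! ## 1. The volume of a constant-centre hull-set preimage; the stable-lattice sandwich of a polydisc -/

/-- **`μ^log(e⁻¹(λ·𝒪_L)) = W_{j,p}·log ρ` in the verbatim container at `(j, p)` for a centre `λ` all of whose
coordinates have norm `ρ`** (e.g. `λ = c ∈ ℚ_p^×` constant, `ρ = ‖c‖`), `W_{j,p} = Σ_{v⃗} w_{v⃗}` (abc-iut-w4-d036's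
closed form `Σ_{(v⃗,i)} (w_{v⃗}·e_i f_i/D_{v⃗})·log‖λ_{v⃗,i}‖` with `Σ_i e_i f_i = D_{v⃗}`; the DH-weight twin of
abc-iut-w4-d107's `logvol_situationPrVol_preimage_hullSet_algebraMap`). [cite: DupuyHilado2025, §3.6, §3.7] -/
theorem logvol_situationDHVol_preimage_hullSet_of_norm_eq (pp : Nat.Primes) (j : (thetaIndex X).Label)
    (lam : ∀ s : factorIdxDH X hlog j (.inr pp), factorFieldDH X hlog j (.inr pp) s) {ρ : ℝ} (hρ : 0 < ρ)
    (hlam : ∀ s, ‖lam s‖ = ρ) :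
    haveI : Fact (pp : ℕ).Prime := ⟨pp.2⟩
    ((situationDHVol X hlog M archPk archSub Ψ act Mmod region).D n).logvol j (.inr pp)
        (factorMapDH X hlog j (.inr pp) ⁻¹' hullSet (factorFieldDH X hlog j (.inr pp)) lam) =
      (∑ e : (presAt X hlog pp).toLocalPieces.E j, (presAt X hlog pp).w j e) * Real.log ρ := by
  haveI : Fact (pp : ℕ).Prime := ⟨pp.2⟩
  classical
  have hlam_ne : ∀ s, lam s ≠ 0 := fun s => norm_pos_iff.mp (by rw [hlam s]; exact hρ)
  rw [logvol_situationDHVol_preimage_hullSet X hlog M archPk archSub Ψ act Mmod region n pp j lam hlam_ne,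
    Finset.sum_mul]
  refine Finset.sum_congr rfl fun e _ => ?_
  -- `Σ_i e_i·f_i = D_{v⃗}` (the definition of the packet degree)
  have hD : (∑ i : DIdx (pp : ℕ) ((presAt X hlog pp).kk e),
      ((absRamificationIdx (pp : ℕ) (DFac (pp : ℕ) ((presAt X hlog pp).kk e) i) : ℝ) *
        (residueDegree (pp : ℕ) (DFac (pp : ℕ) ((presAt X hlog pp).kk e) i) : ℝ))) =
      (packetDegree (pp : ℕ) (DFac (pp : ℕ) ((presAt X hlog pp).kk e)) : ℝ) := by
    simp only [packetDegree, Nat.cast_sum, Nat.cast_mul]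
  have hDpos : (0 : ℝ) < (packetDegree (pp : ℕ) (DFac (pp : ℕ) ((presAt X hlog pp).kk e)) : ℝ) := by
    exact_mod_cast packetDegree_pos (pp : ℕ) (DFac (pp : ℕ) ((presAt X hlog pp).kk e))
  have hterm : ∀ i : DIdx (pp : ℕ) ((presAt X hlog pp).kk e),
      (presAt X hlog pp).w j e * (((packetDegree (pp : ℕ) (DFac (pp : ℕ) ((presAt X hlog pp).kk e)) : ℝ))⁻¹ *
          ((absRamificationIdx (pp : ℕ) (DFac (pp : ℕ) ((presAt X hlog pp).kk e) i) : ℝ) *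
            residueDegree (pp : ℕ) (DFac (pp : ℕ) ((presAt X hlog pp).kk e) i))) * Real.log ‖lam ⟨e, i⟩‖ =
        (presAt X hlog pp).w j e * (((packetDegree (pp : ℕ) (DFac (pp : ℕ) ((presAt X hlog pp).kk e)) : ℝ))⁻¹ *
          ((absRamificationIdx (pp : ℕ) (DFac (pp : ℕ) ((presAt X hlog pp).kk e) i) : ℝ) *
            residueDegree (pp : ℕ) (DFac (pp : ℕ) ((presAt X hlog pp).kk e) i))) * Real.log ρ := fun i => by
    rw [hlam]
  rw [Finset.sum_congr rfl fun i _ => hterm i, ← Finset.sum_mul, ← Finset.mul_sum, ← Finset.mul_sum, hD,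
    inv_mul_cancel₀ hDpos.ne', mul_one]

/-- The total weight `W_{j,p} = Σ_{v⃗} w_{v⃗}` of the packet is nonnegative. [cite: DupuyHilado2025, §3.6] -/
theorem sum_w_presAt_nonneg (pp : Nat.Primes) (j : (thetaIndex X).Label) :
    haveI : Fact (pp : ℕ).Prime := ⟨pp.2⟩
    0 ≤ ∑ e : (presAt X hlog pp).toLocalPieces.E j, (presAt X hlog pp).w j e := by
  haveI : Fact (pp : ℕ).Prime := ⟨pp.2⟩
  exact Finset.sum_nonneg fun e _ => (presAt X hlog pp).w_nonneg j e

/-- **The stable-lattice SANDWICH of a coordinate polydisc** (abc-iut-w4-d107's steps (1)–(3), exported): for an inner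
radius `r` and an outer radius `R` of the log-shell lattice `latticeF 1` of the packet `(j, p)` and any `ρ > 0`, there
are a scalar `c ≠ 0` and an exponent `N` with `p^N ≤ p²·R·ρ/r` such that the coordinate polydisc of radius `ρ` lies in
the (Ind1)/(Ind2)-STABLE scaled log-shell lattice `e⁻¹(Π_{v⃗} c·I_{v⃗})` (abc-iut-c312-5 `latticePk`,
`family_image_latticePk`), which lies in the hull-set `e⁻¹(p^{−N}·𝒪_L)` (coordinates of norm `≤ p^N`).
[cite: DupuyHilado2025, §4.9, §4.10] -/
theorem exists_latticePk_sandwich (pp : Nat.Primes) (j : (thetaIndex X).Label) {r R ρ : ℝ} (hr : 0 < r)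
    (hR : 0 < R) (hρ : 0 < ρ)
    (hball : haveI : Fact (pp : ℕ).Prime := ⟨pp.2⟩
      ∀ z : (∀ s : (presAt X hlog pp).factorIdx j, (presAt X hlog pp).factorField j s),
        (∀ s, ‖z s‖ < r) → z ∈ (presAt X hlog pp).latticeF j 1)
    (hbdd : haveI : Fact (pp : ℕ).Prime := ⟨pp.2⟩
      ∀ z ∈ (presAt X hlog pp).latticeF j 1, ∀ s, ‖z s‖ ≤ R) :
    haveI : Fact (pp : ℕ).Prime := ⟨pp.2⟩
    ∃ (c : ℚ_[pp]) (N : ℤ), c ≠ 0 ∧ ((pp : ℕ) : ℝ) ^ N ≤ ((pp : ℕ) : ℝ) ^ 2 * R * ρ / r ∧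
      (∀ Φ ∈ (logShellsDH X logv).Ind1Family ∪ (logShellsDH X logv).Ind2Family,
        Φ j (.inr pp) '' (presAt X hlog pp).latticePk j c = (presAt X hlog pp).latticePk j c) ∧
      {x : (logShellsDH X logv).Packet j (.inr pp) | ∀ s, ‖(presAt X hlog pp).factorMap j x s‖ ≤ ρ} ⊆
        (presAt X hlog pp).latticePk j c ∧
      (presAt X hlog pp).latticePk j c ⊆
        (fun x => (presAt X hlog pp).factorMap j x) ⁻¹' hullSet ((presAt X hlog pp).factorField j)
          (fun s => algebraMap ℚ_[pp] ((presAt X hlog pp).factorField j s) (((pp : ℕ) : ℚ_[pp]) ^ (-N))) := by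
  haveI : Fact (pp : ℕ).Prime := ⟨pp.2⟩
  classical
  set Pp := presAt X hlog pp with hPp
  have hp1 : (1 : ℝ) < (pp : ℕ) := by exact_mod_cast (Fact.out : (pp : ℕ).Prime).one_lt
  have hp0 : (0 : ℝ) < (pp : ℕ) := zero_lt_one.trans hp1
  have hpne : ((pp : ℕ) : ℚ_[pp]) ≠ 0 := by exact_mod_cast (Fact.out : (pp : ℕ).Prime).ne_zero
  -- (1) the scale `c = p^{-(k+1)}` with `ρ/r < ‖c‖ ≤ p·ρ/r`
  obtain ⟨k, hk⟩ := exists_mem_Ico_zpow (div_pos hρ hr) hp1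
  set c : ℚ_[pp] := ((pp : ℕ) : ℚ_[pp]) ^ (-(k + 1)) with hc
  have hcnorm : ‖c‖ = ((pp : ℕ) : ℝ) ^ (k + 1) := by rw [hc, Padic.norm_p_zpow, neg_neg]
  have hcne : c ≠ 0 := zpow_ne_zero _ hpne
  have hclo : ρ < ‖c‖ * r := by rw [hcnorm]; exact (div_lt_iff₀ hr).mp hk.2
  have hchi : ‖c‖ ≤ (pp : ℕ) * (ρ / r) := by
    rw [hcnorm, zpow_add_one₀ hp0.ne', mul_comm]; exact mul_le_mul_of_nonneg_left hk.1 hp0.le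
  -- (2) the enclosing exponent `N = k₂+1` with `‖c‖·R < p^N ≤ p·‖c‖·R ≤ p²·R·ρ/r`
  obtain ⟨k₂, hk₂⟩ := exists_mem_Ico_zpow (mul_pos (norm_pos_iff.mpr hcne) hR) hp1
  have hB : ((pp : ℕ) : ℝ) ^ (k₂ + 1) ≤ ((pp : ℕ) : ℝ) ^ 2 * R * ρ / r := by
    calc ((pp : ℕ) : ℝ) ^ (k₂ + 1) ≤ (pp : ℕ) * (‖c‖ * R) := by
          rw [zpow_add_one₀ hp0.ne', mul_comm]; exact mul_le_mul_of_nonneg_left hk₂.1 hp0.le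
      _ ≤ (pp : ℕ) * ((pp : ℕ) * (ρ / r) * R) :=
          mul_le_mul_of_nonneg_left (mul_le_mul_of_nonneg_right hchi hR.le) hp0.le
      _ = ((pp : ℕ) : ℝ) ^ 2 * R * ρ / r := by ring
  have hlam_norm : ∀ s : Pp.factorIdx j,
      ‖algebraMap ℚ_[pp] (Pp.factorField j s) (((pp : ℕ) : ℚ_[pp]) ^ (-(k₂ + 1)))‖ = ((pp : ℕ) : ℝ) ^ (k₂ + 1) :=
    fun s => by rw [norm_algebraMap', Padic.norm_p_zpow, neg_neg]
  refine ⟨c, k₂ + 1, hcne, hB, fun Φ hΦ => Pp.family_image_latticePk hΦ j c, fun x hx => ?_, fun x hx => ?_⟩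
  · -- the polydisc of radius `ρ < ‖c‖·r` lies in `latticePk c`
    exact (Pp.mem_latticePk_iff_factorMap c x).2 (Pp.subset_latticeF_of_norm_le hball hcne hclo hx)
  · -- `latticePk c` lies in the polydisc of radius `‖c‖·R < p^N`
    have hx' : (fun s => Pp.factorMap j x s) ∈ Pp.latticeF j c := (Pp.mem_latticePk_iff_factorMap c x).1 hx
    show (fun s => Pp.factorMap j x s) ∈ hullSet (Pp.factorField j) _
    rw [hullSet, mem_polydisc]
    intro s
    rw [hlam_norm s]
    exact (Pp.norm_le_of_mem_latticeF hbdd hcne hx' s).trans hk₂.2.le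

/-! ## 2. At `Real.settingDHVol` (generic Θ-boxes): containers for `^{n,∘}𝒰` and for `^{n,∘}𝒰♮`, and their volumes -/

section Generic

variable
  (thetaBox : ℤ → Ob sig.Clgp → ∀ (j : (thetaIndex X).Label) (vQ : (thetaIndex X).VQ),
    Set (∀ s : factorIdxDH X hlog j vQ, factorFieldDH X hlog j vQ s))
  (qCentre : ObΔ → ∀ (j : (thetaIndex X).Label) (vQ : (thetaIndex X).VQ),
    ∀ s : factorIdxDH X hlog j vQ, factorFieldDH X hlog j vQ s)
  (hq : ∀ j vQ s, qCentre (qPilotObject qData) j vQ s ≠ 0)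
  (hfin : ∀ j : (thetaIndex X).Label, (Function.support fun vQ =>
    ((situationDHVol X hlog M archPk archSub Ψ act Mmod region).D n).logvol j vQ
      (factorMapDH X hlog j vQ ⁻¹' hullSet (factorFieldDH X hlog j vQ) (qCentre (qPilotObject qData) j vQ))).Finite)

/-- **`^{n,∘}𝒰_{j,p}` inside an explicit hull-set** at ANY prime: if every Θ-box at `(j, p)` = `(labelSucc i₀, p)` lies
in the coordinate polydisc of radius `ρ`, then `^{n,∘}𝒰_{j,p} ⊆ e⁻¹(p^{−N}·𝒪_L)` for some `N` with `p^N ≤ p²·R·ρ/r` —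
the union of ALL possible images lies in the stable lattice of §1 (abc-iut-c312-7 `sUnion_possibleImages_subset`),
and the hull is "the smallest `λ·𝒪_L` containing" it. The SET form of abc-iut-w4-d107's volume bound.
[cite: Mochizuki2012, IUTchIV Thm 1.10 proof Step (v) pp. 27–29] [cite: DupuyHilado2025, §4.10] -/
theorem thetaHull_settingDHVol_subset_hullSet_of_polydisc (pp : Nat.Primes) (i₀ : Fin (thetaIndex X).lstar)
    {r R ρ : ℝ} (hr : 0 < r) (hR : 0 < R) (hρ : 0 < ρ)
    (hball : haveI : Fact (pp : ℕ).Prime := ⟨pp.2⟩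
      ∀ z : (∀ s : (presAt X hlog pp).factorIdx (labelSucc i₀), (presAt X hlog pp).factorField (labelSucc i₀) s),
        (∀ s, ‖z s‖ < r) → z ∈ (presAt X hlog pp).latticeF (labelSucc i₀) 1)
    (hbdd : haveI : Fact (pp : ℕ).Prime := ⟨pp.2⟩
      ∀ z ∈ (presAt X hlog pp).latticeF (labelSucc i₀) 1, ∀ s, ‖z s‖ ≤ R)
    (hΘ : ∀ m : ℤ, thetaBox m (thetaPilotObject sig split) (labelSucc i₀) (.inr pp) ⊆ {z | ∀ s, ‖z s‖ ≤ ρ}) :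
    haveI : Fact (pp : ℕ).Prime := ⟨pp.2⟩
    ∃ N : ℤ, ((pp : ℕ) : ℝ) ^ N ≤ ((pp : ℕ) : ℝ) ^ 2 * R * ρ / r ∧
      (settingDHVol X hlog M archPk archSub Ψ act Mmod region n lat sig split qData thetaBox qCentre hq
          hfin).thetaHull (labelSucc i₀) (.inr pp) ⊆
        (fun x => (presAt X hlog pp).factorMap (labelSucc i₀) x) ⁻¹'
          hullSet ((presAt X hlog pp).factorField (labelSucc i₀))
            (fun s => algebraMap ℚ_[pp] ((presAt X hlog pp).factorField (labelSucc i₀) s)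
              (((pp : ℕ) : ℚ_[pp]) ^ (-N))) := by
  haveI : Fact (pp : ℕ).Prime := ⟨pp.2⟩
  set Pp := presAt X hlog pp with hPp
  set j : (thetaIndex X).Label := labelSucc i₀ with hj
  set P := settingDHVol X hlog M archPk archSub Ψ act Mmod region n lat sig split qData thetaBox qCentre hq hfin
  obtain ⟨c, N, hcne, hN, hWst, hρW, hWH⟩ :=
    exists_latticePk_sandwich X hlog pp j hr hR hρ hball hbdd
  have hpne : ((pp : ℕ) : ℚ_[pp]) ≠ 0 := by exact_mod_cast (Fact.out : (pp : ℕ).Prime).ne_zero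
  have hlam_ne : ∀ s : Pp.factorIdx j,
      algebraMap ℚ_[pp] (Pp.factorField j s) (((pp : ℕ) : ℚ_[pp]) ^ (-N)) ≠ 0 := fun s =>
    (map_ne_zero (algebraMap ℚ_[pp] (Pp.factorField j s))).2 (zpow_ne_zero _ hpne)
  refine ⟨N, hN, ?_⟩
  -- the (Ind3)-region lies in the polydisc, hence in the stable lattice; so do all possible images; take the hull
  have h3 : P.thetaRegion3 j (.inr pp) ⊆ Pp.latticePk j c := by
    intro x hx
    rw [Setting.thetaRegion3, Set.mem_iUnion] at hx
    obtain ⟨m, hm⟩ := hx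
    have hm' : (fun s => Pp.factorMap j x s) ∈ thetaBox m (thetaPilotObject sig split) j (.inr pp) := hm
    exact hρW (hΘ m hm')
  have hHul : (fun x => Pp.factorMap j x) ⁻¹' hullSet (Pp.factorField j)
      (fun s => algebraMap ℚ_[pp] (Pp.factorField j s) (((pp : ℕ) : ℚ_[pp]) ^ (-N))) ∈ (P.frame j (.inr pp)).Hul :=
    ⟨_, ⟨_, hlam_ne, rfl⟩, rfl⟩
  exact (P.frame j (.inr pp)).hull_subset_of_mem hHul ((P.sUnion_possibleImages_subset hWst h3).trans hWH)

/-- **`^{n,∘}𝒰♮_{j,p}` inside an explicit hull-set, NO stability of `^{n,∘}𝒰`**: under the same hypotheses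
`^{n,∘}𝒰♮_{j,p} ⊆ e⁻¹(p^{−N'}·𝒪_L)` for some `N'` with `p^{N'} ≤ p⁴·R²·ρ/r²` — the sandwich of §1 run on the polydisc
`e⁻¹(p^{−N}·𝒪_L) ⊇ ^{n,∘}𝒰_{j,p}`: the stable lattice absorbing it carries EVERY (Ind1),(Ind2)-translate of `^{n,∘}𝒰`
(this seat's `hullGlued_thetaHull_subset_of_stable`). [cite: Mochizuki2012, IUTchIV Thm 1.10 proof Step (v) pp. 27–29]
[cite: DupuyHilado2025, §4.10] -/
theorem hullGlued_thetaHull_settingDHVol_subset_hullSet_of_polydisc (pp : Nat.Primes) (i₀ : Fin (thetaIndex X).lstar)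
    {r R ρ : ℝ} (hr : 0 < r) (hR : 0 < R) (hρ : 0 < ρ)
    (hball : haveI : Fact (pp : ℕ).Prime := ⟨pp.2⟩
      ∀ z : (∀ s : (presAt X hlog pp).factorIdx (labelSucc i₀), (presAt X hlog pp).factorField (labelSucc i₀) s),
        (∀ s, ‖z s‖ < r) → z ∈ (presAt X hlog pp).latticeF (labelSucc i₀) 1)
    (hbdd : haveI : Fact (pp : ℕ).Prime := ⟨pp.2⟩
      ∀ z ∈ (presAt X hlog pp).latticeF (labelSucc i₀) 1, ∀ s, ‖z s‖ ≤ R)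
    (hΘ : ∀ m : ℤ, thetaBox m (thetaPilotObject sig split) (labelSucc i₀) (.inr pp) ⊆ {z | ∀ s, ‖z s‖ ≤ ρ}) :
    haveI : Fact (pp : ℕ).Prime := ⟨pp.2⟩
    ∃ N' : ℤ, ((pp : ℕ) : ℝ) ^ N' ≤ ((pp : ℕ) : ℝ) ^ 4 * R ^ 2 * ρ / r ^ 2 ∧
      (settingDHVol X hlog M archPk archSub Ψ act Mmod region n lat sig split qData thetaBox qCentre hq
          hfin).hullGlued.thetaHull (labelSucc i₀) (.inr pp) ⊆
        (fun x => (presAt X hlog pp).factorMap (labelSucc i₀) x) ⁻¹'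
          hullSet ((presAt X hlog pp).factorField (labelSucc i₀))
            (fun s => algebraMap ℚ_[pp] ((presAt X hlog pp).factorField (labelSucc i₀) s)
              (((pp : ℕ) : ℚ_[pp]) ^ (-N'))) := by
  haveI : Fact (pp : ℕ).Prime := ⟨pp.2⟩
  set Pp := presAt X hlog pp with hPp
  set j : (thetaIndex X).Label := labelSucc i₀ with hj
  set P := settingDHVol X hlog M archPk archSub Ψ act Mmod region n lat sig split qData thetaBox qCentre hq hfin
  have hp1 : (1 : ℝ) < (pp : ℕ) := by exact_mod_cast (Fact.out : (pp : ℕ).Prime).one_lt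
  have hp0 : (0 : ℝ) < (pp : ℕ) := zero_lt_one.trans hp1
  have hpne : ((pp : ℕ) : ℚ_[pp]) ≠ 0 := by exact_mod_cast (Fact.out : (pp : ℕ).Prime).ne_zero
  -- the container of `^{n,∘}𝒰`: the polydisc of radius `ρ₁ = p^N ≤ p²·R·ρ/r`
  obtain ⟨N, hN, hsub⟩ := thetaHull_settingDHVol_subset_hullSet_of_polydisc X hlog M archPk archSub Ψ act Mmod region
    n lat sig split qData thetaBox qCentre hq hfin pp i₀ hr hR hρ hball hbdd hΘ
  have hρ₁ : (0 : ℝ) < ((pp : ℕ) : ℝ) ^ N := zpow_pos hp0 _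
  have hsub' : P.thetaHull j (.inr pp) ⊆ {x | ∀ s, ‖Pp.factorMap j x s‖ ≤ ((pp : ℕ) : ℝ) ^ N} := by
    intro x hx s
    have hx' := (mem_polydisc (Pp.factorField j)).1 (hsub hx) s
    rwa [norm_algebraMap', Padic.norm_p_zpow, neg_neg] at hx'
  -- the sandwich run on that polydisc
  obtain ⟨c, N', hcne, hN', hWst, hρW, hWH⟩ :=
    exists_latticePk_sandwich X hlog pp j hr hR hρ₁ hball hbdd
  have hlam_ne : ∀ s : Pp.factorIdx j,
      algebraMap ℚ_[pp] (Pp.factorField j s) (((pp : ℕ) : ℚ_[pp]) ^ (-N')) ≠ 0 := fun s =>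
    (map_ne_zero (algebraMap ℚ_[pp] (Pp.factorField j s))).2 (zpow_ne_zero _ hpne)
  have hHul : (fun x => Pp.factorMap j x) ⁻¹' hullSet (Pp.factorField j)
      (fun s => algebraMap ℚ_[pp] (Pp.factorField j s) (((pp : ℕ) : ℚ_[pp]) ^ (-N'))) ∈ (P.frame j (.inr pp)).Hul :=
    ⟨_, ⟨_, hlam_ne, rfl⟩, rfl⟩
  refine ⟨N', ?_, P.hullGlued_thetaHull_subset_of_stable hWst (hsub'.trans hρW) hHul hWH⟩
  calc ((pp : ℕ) : ℝ) ^ N' ≤ ((pp : ℕ) : ℝ) ^ 2 * R * ((pp : ℕ) : ℝ) ^ N / r := hN'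
    _ ≤ ((pp : ℕ) : ℝ) ^ 2 * R * (((pp : ℕ) : ℝ) ^ 2 * R * ρ / r) / r := by gcongr
    _ = ((pp : ℕ) : ℝ) ^ 4 * R ^ 2 * ρ / r ^ 2 := by
      field_simp

/-- **`μ^log(^{n,∘}𝒰_{j,p}) ≤ W_{j,p}·log(p²·R·ρ/r)`** at ANY prime under abc-iut-c312-6's `BridgeHyps` (the
DH-weight twin of abc-iut-w4-d107's `thetaLocal_settingPrVol_untopD_le_of_polydisc`; monotone verbatim volumes).
[claim: Mochizuki2012, status: disputed] [cite: DupuyHilado2025, §4.10] -/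
theorem thetaLocal_settingDHVol_untopD_le_of_polydisc (pp : Nat.Primes) (i₀ : Fin (thetaIndex X).lstar)
    {r R ρ : ℝ} (hr : 0 < r) (hR : 0 < R) (hρ : 0 < ρ)
    (hball : haveI : Fact (pp : ℕ).Prime := ⟨pp.2⟩
      ∀ z : (∀ s : (presAt X hlog pp).factorIdx (labelSucc i₀), (presAt X hlog pp).factorField (labelSucc i₀) s),
        (∀ s, ‖z s‖ < r) → z ∈ (presAt X hlog pp).latticeF (labelSucc i₀) 1)
    (hbdd : haveI : Fact (pp : ℕ).Prime := ⟨pp.2⟩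
      ∀ z ∈ (presAt X hlog pp).latticeF (labelSucc i₀) 1, ∀ s, ‖z s‖ ≤ R)
    (hΘ : ∀ m : ℤ, thetaBox m (thetaPilotObject sig split) (labelSucc i₀) (.inr pp) ⊆ {z | ∀ s, ‖z s‖ ≤ ρ})
    (H : BridgeHyps (settingDHVol X hlog M archPk archSub Ψ act Mmod region n lat sig split qData thetaBox qCentre hq
      hfin)) :
    haveI : Fact (pp : ℕ).Prime := ⟨pp.2⟩
    ((settingDHVol X hlog M archPk archSub Ψ act Mmod region n lat sig split qData thetaBox qCentre hq
        hfin).thetaLocal (labelSucc i₀) (.inr pp)).untopD 0 ≤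
      (∑ e : (presAt X hlog pp).toLocalPieces.E (labelSucc i₀), (presAt X hlog pp).w (labelSucc i₀) e) *
        Real.log (((pp : ℕ) : ℝ) ^ 2 * R * ρ / r) := by
  haveI : Fact (pp : ℕ).Prime := ⟨pp.2⟩
  set Pp := presAt X hlog pp with hPp
  set j : (thetaIndex X).Label := labelSucc i₀ with hj
  set P := settingDHVol X hlog M archPk archSub Ψ act Mmod region n lat sig split qData thetaBox qCentre hq hfin
  have hp1 : (1 : ℝ) < (pp : ℕ) := by exact_mod_cast (Fact.out : (pp : ℕ).Prime).one_lt
  have hp0 : (0 : ℝ) < (pp : ℕ) := zero_lt_one.trans hp1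
  have hpne : ((pp : ℕ) : ℚ_[pp]) ≠ 0 := by exact_mod_cast (Fact.out : (pp : ℕ).Prime).ne_zero
  obtain ⟨N, hN, hsub⟩ := thetaHull_settingDHVol_subset_hullSet_of_polydisc X hlog M archPk archSub Ψ act Mmod region
    n lat sig split qData thetaBox qCentre hq hfin pp i₀ hr hR hρ hball hbdd hΘ
  have hlam_norm : ∀ s : Pp.factorIdx j,
      ‖algebraMap ℚ_[pp] (Pp.factorField j s) (((pp : ℕ) : ℚ_[pp]) ^ (-N))‖ = ((pp : ℕ) : ℝ) ^ N := fun s => by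
    rw [norm_algebraMap', Padic.norm_p_zpow, neg_neg]
  have hlam_ne : ∀ s : Pp.factorIdx j, algebraMap ℚ_[pp] (Pp.factorField j s) (((pp : ℕ) : ℚ_[pp]) ^ (-N)) ≠ 0 :=
    fun s => (map_ne_zero _).2 (zpow_ne_zero _ hpne)
  have hHul : (fun x => Pp.factorMap j x) ⁻¹' hullSet (Pp.factorField j)
      (fun s => algebraMap ℚ_[pp] (Pp.factorField j s) (((pp : ℕ) : ℚ_[pp]) ^ (-N))) ∈ (P.frame j (.inr pp)).Hul :=
    ⟨_, ⟨_, hlam_ne, rfl⟩, rfl⟩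
  rw [thetaLocal_untopD H i₀ (.inr pp)]
  refine ((H.mono i₀ (.inr pp) (P.thetaHull_adm (hullDefined_of_finite H i₀ (.inr pp))) (P.hul_adm _ _ _ hHul)
    hsub).trans_eq ?_).trans (mul_le_mul_of_nonneg_left (Real.log_le_log (zpow_pos hp0 N) hN)
      (sum_w_presAt_nonneg X hlog pp j))
  exact logvol_situationDHVol_preimage_hullSet_of_norm_eq X hlog M archPk archSub Ψ act Mmod region n pp j _
    (zpow_pos hp0 N) hlam_norm

/-- **`μ^log(^{n,∘}𝒰♮_{j,p}) ≤ W_{j,p}·log(p⁴·R²·ρ/r²)`** at ANY prime under `BridgeHyps P` (`HullDefined♮` by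
abc-iut-w5-d060's `hullGlued_hullDefined_settingDHVol`; monotone verbatim volumes): the hull-gluing costs at most
`W_{j,p}·log(p²·R/r)` over the container bound for `P` — a constant of the packet that does not read the Θ-data.
NO stability of `^{n,∘}𝒰` is used. [claim: Mochizuki2012, status: disputed]
[cite: Mochizuki2012, IUTchIV Thm 1.10 proof Step (v) pp. 27–29] [cite: DupuyHilado2025, §4.10] -/
theorem hullGlued_thetaLocal_settingDHVol_untopD_le_of_polydisc (pp : Nat.Primes) (i₀ : Fin (thetaIndex X).lstar)
    {r R ρ : ℝ} (hr : 0 < r) (hR : 0 < R) (hρ : 0 < ρ)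
    (hball : haveI : Fact (pp : ℕ).Prime := ⟨pp.2⟩
      ∀ z : (∀ s : (presAt X hlog pp).factorIdx (labelSucc i₀), (presAt X hlog pp).factorField (labelSucc i₀) s),
        (∀ s, ‖z s‖ < r) → z ∈ (presAt X hlog pp).latticeF (labelSucc i₀) 1)
    (hbdd : haveI : Fact (pp : ℕ).Prime := ⟨pp.2⟩
      ∀ z ∈ (presAt X hlog pp).latticeF (labelSucc i₀) 1, ∀ s, ‖z s‖ ≤ R)
    (hΘ : ∀ m : ℤ, thetaBox m (thetaPilotObject sig split) (labelSucc i₀) (.inr pp) ⊆ {z | ∀ s, ‖z s‖ ≤ ρ})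
    (H : BridgeHyps (settingDHVol X hlog M archPk archSub Ψ act Mmod region n lat sig split qData thetaBox qCentre hq
      hfin)) :
    haveI : Fact (pp : ℕ).Prime := ⟨pp.2⟩
    ((settingDHVol X hlog M archPk archSub Ψ act Mmod region n lat sig split qData thetaBox qCentre hq
        hfin).hullGlued.thetaLocal (labelSucc i₀) (.inr pp)).untopD 0 ≤
      (∑ e : (presAt X hlog pp).toLocalPieces.E (labelSucc i₀), (presAt X hlog pp).w (labelSucc i₀) e) *
        Real.log (((pp : ℕ) : ℝ) ^ 4 * R ^ 2 * ρ / r ^ 2) := by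
  haveI : Fact (pp : ℕ).Prime := ⟨pp.2⟩
  set Pp := presAt X hlog pp with hPp
  set j : (thetaIndex X).Label := labelSucc i₀ with hj
  set P := settingDHVol X hlog M archPk archSub Ψ act Mmod region n lat sig split qData thetaBox qCentre hq hfin
  have hp1 : (1 : ℝ) < (pp : ℕ) := by exact_mod_cast (Fact.out : (pp : ℕ).Prime).one_lt
  have hp0 : (0 : ℝ) < (pp : ℕ) := zero_lt_one.trans hp1
  have hpne : ((pp : ℕ) : ℚ_[pp]) ≠ 0 := by exact_mod_cast (Fact.out : (pp : ℕ).Prime).ne_zero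
  obtain ⟨N', hN', hsub'⟩ := hullGlued_thetaHull_settingDHVol_subset_hullSet_of_polydisc X hlog M archPk archSub Ψ act
    Mmod region n lat sig split qData thetaBox qCentre hq hfin pp i₀ hr hR hρ hball hbdd hΘ
  have hlam_norm : ∀ s : Pp.factorIdx j,
      ‖algebraMap ℚ_[pp] (Pp.factorField j s) (((pp : ℕ) : ℚ_[pp]) ^ (-N'))‖ = ((pp : ℕ) : ℝ) ^ N' := fun s => by
    rw [norm_algebraMap', Padic.norm_p_zpow, neg_neg]
  have hlam_ne : ∀ s : Pp.factorIdx j, algebraMap ℚ_[pp] (Pp.factorField j s) (((pp : ℕ) : ℚ_[pp]) ^ (-N')) ≠ 0 :=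
    fun s => (map_ne_zero _).2 (zpow_ne_zero _ hpne)
  have hHul : (fun x => Pp.factorMap j x) ⁻¹' hullSet (Pp.factorField j)
      (fun s => algebraMap ℚ_[pp] (Pp.factorField j s) (((pp : ℕ) : ℚ_[pp]) ^ (-N'))) ∈ (P.frame j (.inr pp)).Hul :=
    ⟨_, ⟨_, hlam_ne, rfl⟩, rfl⟩
  have hdef' : P.hullGlued.HullDefined j (.inr pp) :=
    hullGlued_hullDefined_settingDHVol X hlog M archPk archSub Ψ act Mmod region n lat sig split qData thetaBox qCentre
      hq hfin j (.inr pp) (hullDefined_of_finite H i₀ (.inr pp))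
  unfold Setting.thetaLocal
  rw [if_pos hdef', WithTop.untopD_coe]
  refine ((H.mono i₀ (.inr pp) (P.hullGlued.thetaHull_adm hdef') (P.hul_adm _ _ _ hHul) hsub').trans_eq ?_).trans
    (mul_le_mul_of_nonneg_left (Real.log_le_log (zpow_pos hp0 N') hN') (sum_w_presAt_nonneg X hlog pp j))
  exact logvol_situationDHVol_preimage_hullSet_of_norm_eq X hlog M archPk archSub Ψ act Mmod region n pp j _
    (zpow_pos hp0 N') hlam_norm

end Generic

end Summit.ABC.IUTFork.Thm311.Real

end
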